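import Mathlib
import Literature.NumberTheory.Transcendental.AxDerivationTools

/-!
# Crux `InverseLandauRationalCurves`, line `Sketch` — kernel helpers, V: Gauss–Manin on
`ℙ¹ ∖ {poles}` relative to `{0, 1}`

Helpers for the lead's stub `stub_kernel` (item stmt-KontsevichZagierPeriods-13872); this file is
independent of the Tate context. `F` is a field of characteristic zero with a derivation `D`
("`d/dϖ` on the coefficients"); on `F(z)` we have the two commuting derivations `∂ = d/dz`
(`∂ z = 1`, `∂|_F = 0`) and `𝔇` (`𝔇 z = 0`, `𝔇|_F = D`).

* existence of `∂`, `𝔇` (`exists_derivation_dz`, `exists_derivation_coeff`) and `[𝔇, ∂] = 0`;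
* quotient rules for `M / Bⁿ` under `∂` and `𝔇`;
* **horizontality step** (`gaussManin_step`): if `H = ∂E + Σ aᵢ/(z - pᵢ)` then
  `𝔇H = ∂(𝔇E - Σ aᵢ·Dpᵢ/(z - pᵢ)) + Σ Daᵢ/(z - pᵢ)`;
* **boundary step** (`boundary_step`): the boundary value `[·]₀¹` of the new exact part is
  `D[E]₀¹ + Σ aᵢ · Dgᵢ/gᵢ` with the Landau functions `gᵢ = (pᵢ - 1)/pᵢ`.
-/

noncomputable section

open Polynomial
open Literature.NumberTheory.Transcendental

namespace Summit.KontsevichZagierPeriods.InverseLandau.RationalCurves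

section GaussManin

variable {k : Type*} [Field k] {F : Type*} [Field F] [Algebra k F]

/-- **`d/dz` on `F(z)`**: a derivation `∂` with `∂ p = p′` on polynomials. -/
theorem exists_derivation_dz :
    ∃ d : Derivation k (RatFunc F) (RatFunc F), ∀ p : F[X],
      d (algebraMap F[X] (RatFunc F) p) = algebraMap F[X] (RatFunc F) (derivative p) := by
  let d₀ : Derivation k F[X] (RatFunc F) :=
    (Polynomial.mkDerivation F (1 : RatFunc F)).restrictScalars k
  have hd₀ : ∀ p : F[X], d₀ p = algebraMap F[X] (RatFunc F) (derivative p) := fun p => by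
    change Polynomial.mkDerivation F (1 : RatFunc F) p = _
    rw [Polynomial.mkDerivation_apply, Algebra.smul_def, mul_one]
  obtain ⟨d, hd⟩ := exists_derivation_extend_of_isFractionRing (R := k) (A := F[X])
    (K := RatFunc F) d₀
  exact ⟨d, fun p => by rw [hd, hd₀]⟩

/-- The coefficientwise image `p^D = Σ D(aᵢ) zⁱ` of a polynomial under an additive map `D`. -/
theorem coeff_sum_monomial (D : F → F) (hD : D 0 = 0) (p : F[X]) (i : ℕ) :
    (p.sum fun j a => monomial j (D a)).coeff i = D (p.coeff i) := by
  rw [Polynomial.sum_def, finsetSum_coeff]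
  simp only [coeff_monomial, Finset.sum_ite_eq']
  split_ifs with h
  · rfl
  · rw [Polynomial.notMem_support_iff.1 h, hD]

/-- **`𝔇` on `F(z)`**: for a derivation `D` of `F`, a derivation `𝔇` of `F(z)` acting
coefficientwise on polynomials (`𝔇 z = 0`, `𝔇 a = D a`). -/
theorem exists_derivation_coeff (D : Derivation k F F) :
    ∃ d : Derivation k (RatFunc F) (RatFunc F), ∀ p : F[X],
      d (algebraMap F[X] (RatFunc F) p) =
        algebraMap F[X] (RatFunc F) (p.sum fun j a => monomial j (D a)) := by
  letI : Differential F := ⟨D.restrictScalars ℤ⟩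
  have hmc : ∀ p : F[X], Differential.mapCoeffs p = p.sum fun j a => monomial j (D a) := by
    intro p
    ext i
    rw [Differential.coeff_mapCoeffs, coeff_sum_monomial D (map_zero D)]
    rfl
  -- the coefficientwise derivation is `k`-linear
  let dF : Derivation k F[X] F[X] :=
    { toFun := fun p => Differential.mapCoeffs p
      map_add' := fun p q => map_add _ p q
      map_smul' := fun c p => by
        simp only [RingHom.id_apply]
        rw [Algebra.smul_def, Algebra.smul_def, Differential.mapCoeffs.leibniz,
          Polynomial.algebraMap_apply, Differential.mapCoeffs_C]
        change _ + p • C ((D.restrictScalars ℤ) (algebraMap k F c)) = _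
        rw [Derivation.restrictScalars_apply, Derivation.map_algebraMap, map_zero, smul_zero,
          add_zero, smul_eq_mul]
      map_one_eq_zero' := Differential.mapCoeffs.map_one_eq_zero
      leibniz' := fun p q => Differential.mapCoeffs.leibniz p q }
  have hdF : ∀ p, dF p = p.sum fun j a => monomial j (D a) := fun p => by rw [← hmc]; rfl
  let d₀ : Derivation k F[X] (RatFunc F) := (Algebra.linearMap F[X] (RatFunc F)).compDer dF
  have hd₀ : ∀ p : F[X], d₀ p = algebraMap F[X] (RatFunc F) (p.sum fun j a => monomial j (D a)) :=
    fun p => by rw [← hdF]; rfl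
  obtain ⟨d, hd⟩ := exists_derivation_extend_of_isFractionRing (R := k) (A := F[X])
    (K := RatFunc F) d₀
  exact ⟨d, fun p => by rw [hd, hd₀]⟩

/-- `∂` kills constants. -/
theorem dz_C (d : Derivation k (RatFunc F) (RatFunc F))
    (hd : ∀ p : F[X], d (algebraMap F[X] (RatFunc F) p) = algebraMap F[X] (RatFunc F) (derivative p))
    (a : F) : d (RatFunc.C a) = 0 := by
  rw [← RatFunc.algebraMap_C, hd, derivative_C, map_zero]

/-- `∂ z = 1`. -/
theorem dz_X (d : Derivation k (RatFunc F) (RatFunc F))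
    (hd : ∀ p : F[X], d (algebraMap F[X] (RatFunc F) p) = algebraMap F[X] (RatFunc F) (derivative p)) :
    d RatFunc.X = 1 := by
  rw [← RatFunc.algebraMap_X, hd, derivative_X, map_one]

/-- `𝔇` acts as `D` on constants. -/
theorem dcoeff_C (D : Derivation k F F) (d : Derivation k (RatFunc F) (RatFunc F))
    (hd : ∀ p : F[X], d (algebraMap F[X] (RatFunc F) p) =
      algebraMap F[X] (RatFunc F) (p.sum fun j a => monomial j (D a)))
    (a : F) : d (RatFunc.C a) = RatFunc.C (D a) := by
  rw [← RatFunc.algebraMap_C, hd, sum_C_index, monomial_zero_left, RatFunc.algebraMap_C]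
  rw [map_zero, map_zero]

/-- `𝔇 z = 0`. -/
theorem dcoeff_X (D : Derivation k F F) (d : Derivation k (RatFunc F) (RatFunc F))
    (hd : ∀ p : F[X], d (algebraMap F[X] (RatFunc F) p) =
      algebraMap F[X] (RatFunc F) (p.sum fun j a => monomial j (D a))) :
    d RatFunc.X = 0 := by
  rw [← RatFunc.algebraMap_X, hd, ← monomial_one_one_eq_X, sum_monomial_index]
  · rw [show ((1 : F)) = ((1 : ℕ) : F) by norm_num, Derivation.map_natCast, map_zero, map_zero]
  · rw [map_zero, map_zero]

/-- Coefficientwise `D` commutes with `d/dz` on polynomials. -/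
theorem derivative_sum_monomial (D : Derivation k F F) (p : F[X]) :
    derivative (p.sum fun j a => monomial j (D a)) =
      (derivative p).sum fun j a => monomial j (D a) := by
  ext i
  rw [coeff_derivative, coeff_sum_monomial D (map_zero D), coeff_sum_monomial D (map_zero D),
    coeff_derivative, Derivation.leibniz, smul_eq_mul, smul_eq_mul,
    show ((i : F) + 1) = ((i + 1 : ℕ) : F) by push_cast; ring, Derivation.map_natCast, mul_zero,
    zero_add, mul_comm]

/-- **`[𝔇, ∂] = 0`** on `F(z)`: the two derivations commute (they commute on `F[z]`, and a
derivation of the fraction field is determined by its values on `F[z]`). -/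
theorem dcoeff_dz_comm (D : Derivation k F F) (dc dz : Derivation k (RatFunc F) (RatFunc F))
    (hdc : ∀ p : F[X], dc (algebraMap F[X] (RatFunc F) p) =
      algebraMap F[X] (RatFunc F) (p.sum fun j a => monomial j (D a)))
    (hdz : ∀ p : F[X], dz (algebraMap F[X] (RatFunc F) p) =
      algebraMap F[X] (RatFunc F) (derivative p))
    (f : RatFunc F) : dc (dz f) = dz (dc f) := by
  have key : ⁅dc, dz⁆ = (0 : Derivation k (RatFunc F) (RatFunc F)) := by
    refine derivation_eq_of_isFractionRing (A := F[X]) _ _ fun p => ?_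
    rw [Derivation.commutator_apply, Derivation.zero_apply, hdz, hdc, hdc, hdz,
      derivative_sum_monomial, sub_self]
  have := congrArg (fun E => E f) key
  simpa [Derivation.commutator_apply, sub_eq_zero] using this

/-- `y · δ(yⁿ) = n · yⁿ · δy` (product rule, subtraction-free form). -/
theorem mul_derivation_pow {K : Type*} [Field K] [Algebra k K] (δ : Derivation k K K) (y : K)
    (n : ℕ) : y * δ (y ^ n) = n * (y ^ n * δ y) := by
  induction n with
  | zero => simp
  | succ n ih =>
    rw [pow_succ, Derivation.leibniz, smul_eq_mul, smul_eq_mul, mul_add, ← mul_assoc y (y ^ n),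
      mul_comm y (y ^ n), mul_assoc (y ^ n) y, ih]
    push_cast
    ring

/-- Quotient rule for `x / yⁿ` under a derivation of a field. -/
theorem derivation_div_pow {K : Type*} [Field K] [Algebra k K] (δ : Derivation k K K) (x y : K)
    (hy : y ≠ 0) (n : ℕ) : δ (x / y ^ n) = (δ x * y - n • (x * δ y)) / y ^ (n + 1) := by
  set q := x / y ^ n with hq
  have hx : x = q * y ^ n := (div_mul_cancel₀ x (pow_ne_zero n hy)).symm
  rw [eq_div_iff (pow_ne_zero _ hy), hx, Derivation.leibniz, smul_eq_mul, smul_eq_mul,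
    nsmul_eq_mul]
  have key := mul_derivation_pow δ y n
  linear_combination (-q) * key

/-- `∂ (M / Bⁿ) = (M′ B - n M B′) / Bⁿ⁺¹`. -/
theorem dz_div_pow (dz : Derivation k (RatFunc F) (RatFunc F))
    (hdz : ∀ p : F[X], dz (algebraMap F[X] (RatFunc F) p) =
      algebraMap F[X] (RatFunc F) (derivative p))
    (M B : F[X]) (hB : B ≠ 0) (n : ℕ) :
    dz (algebraMap F[X] (RatFunc F) M / algebraMap F[X] (RatFunc F) (B ^ n)) =
      algebraMap F[X] (RatFunc F) (derivative M * B - n • (M * derivative B)) /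
        algebraMap F[X] (RatFunc F) (B ^ (n + 1)) := by
  have hB' : algebraMap F[X] (RatFunc F) B ≠ 0 :=
    (map_ne_zero_iff _ (IsFractionRing.injective F[X] (RatFunc F))).2 hB
  rw [map_pow, derivation_div_pow dz _ _ hB' n, hdz, hdz, map_pow, map_sub, map_nsmul, map_mul,
    map_mul]

/-- `𝔇 (M / Bⁿ) = (M^D B - n M B^D) / Bⁿ⁺¹`. -/
theorem dcoeff_div_pow (D : Derivation k F F) (dc : Derivation k (RatFunc F) (RatFunc F))
    (hdc : ∀ p : F[X], dc (algebraMap F[X] (RatFunc F) p) =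
      algebraMap F[X] (RatFunc F) (p.sum fun j a => monomial j (D a)))
    (M B : F[X]) (hB : B ≠ 0) (n : ℕ) :
    dc (algebraMap F[X] (RatFunc F) M / algebraMap F[X] (RatFunc F) (B ^ n)) =
      algebraMap F[X] (RatFunc F) ((M.sum fun j a => monomial j (D a)) * B -
        n • (M * B.sum fun j a => monomial j (D a))) /
        algebraMap F[X] (RatFunc F) (B ^ (n + 1)) := by
  have hB' : algebraMap F[X] (RatFunc F) B ≠ 0 :=
    (map_ne_zero_iff _ (IsFractionRing.injective F[X] (RatFunc F))).2 hB
  rw [map_pow, derivation_div_pow dc _ _ hB' n, hdc, hdc, map_pow, map_sub, map_nsmul, map_mul,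
    map_mul]

/-- `𝔇` of a simple polar term: `𝔇 (a/(z-p)) = Da/(z-p) + a·Dp/(z-p)²`. -/
theorem dcoeff_polar (D : Derivation k F F) (dc : Derivation k (RatFunc F) (RatFunc F))
    (hdc : ∀ p : F[X], dc (algebraMap F[X] (RatFunc F) p) =
      algebraMap F[X] (RatFunc F) (p.sum fun j a => monomial j (D a)))
    (a p : F) :
    dc (RatFunc.C a * (RatFunc.X - RatFunc.C p)⁻¹) =
      RatFunc.C (D a) * (RatFunc.X - RatFunc.C p)⁻¹ +
        RatFunc.C (a * D p) * ((RatFunc.X - RatFunc.C p)⁻¹) ^ 2 := by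
  rw [Derivation.leibniz, Derivation.leibniz_inv, map_sub, dcoeff_X D dc hdc, dcoeff_C D dc hdc,
    dcoeff_C D dc hdc, zero_sub, smul_eq_mul, smul_eq_mul, smul_eq_mul, map_mul]
  ring

/-- `∂` of a simple polar term: `∂ (b/(z-p)) = -b/(z-p)²`. -/
theorem dz_polar (dz : Derivation k (RatFunc F) (RatFunc F))
    (hdz : ∀ p : F[X], dz (algebraMap F[X] (RatFunc F) p) =
      algebraMap F[X] (RatFunc F) (derivative p))
    (b p : F) :
    dz (RatFunc.C b * (RatFunc.X - RatFunc.C p)⁻¹) =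
      -(RatFunc.C b * ((RatFunc.X - RatFunc.C p)⁻¹) ^ 2) := by
  rw [Derivation.leibniz, Derivation.leibniz_inv, map_sub, dz_X dz hdz, dz_C dz hdz, dz_C dz hdz,
    sub_zero, smul_eq_mul, smul_eq_mul, smul_eq_mul]
  ring

/-- **Horizontality step (Gauss–Manin).** If `H = ∂E + Σᵢ aᵢ/(z - pᵢ)` in `F(z)`, then
`𝔇H = ∂(𝔇E - Σᵢ aᵢ·Dpᵢ/(z - pᵢ)) + Σᵢ Daᵢ/(z - pᵢ)`: the `ϖ`-derivative of a form with
simple poles has residues `Daᵢ`, and its exact part is corrected by `-Σ aᵢ Dpᵢ/(z - pᵢ)`. -/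
theorem gaussManin_step (D : Derivation k F F) (dc dz : Derivation k (RatFunc F) (RatFunc F))
    (hdc : ∀ p : F[X], dc (algebraMap F[X] (RatFunc F) p) =
      algebraMap F[X] (RatFunc F) (p.sum fun j a => monomial j (D a)))
    (hdz : ∀ p : F[X], dz (algebraMap F[X] (RatFunc F) p) =
      algebraMap F[X] (RatFunc F) (derivative p))
    {ι : Type*} [Fintype ι] (p a : ι → F) (H E : RatFunc F)
    (hH : H = dz E + ∑ i, RatFunc.C (a i) * (RatFunc.X - RatFunc.C (p i))⁻¹) :
    dc H = dz (dc E - ∑ i, RatFunc.C (a i * D (p i)) * (RatFunc.X - RatFunc.C (p i))⁻¹) +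
      ∑ i, RatFunc.C (D (a i)) * (RatFunc.X - RatFunc.C (p i))⁻¹ := by
  rw [hH, map_add, map_sum, dcoeff_dz_comm D dc dz hdc hdz, map_sub, map_sum]
  simp only [dcoeff_polar D dc hdc, dz_polar dz hdz, Finset.sum_add_distrib, Finset.sum_neg_distrib]
  ring

/-- A simple polar term written over the common denominator `Bⁿ⁺¹` (for `p` a root of `B`):
`b/(z-p) = b·(B/(z-p))·Bⁿ / Bⁿ⁺¹`. -/
theorem polar_eq_div_pow (B : F[X]) (hB : B ≠ 0) {p : F} (hp : B.IsRoot p) (b : F) (n : ℕ) :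
    RatFunc.C b * (RatFunc.X - RatFunc.C p)⁻¹ =
      algebraMap F[X] (RatFunc F) (b • (B /ₘ (X - C p)) * B ^ n) /
        algebraMap F[X] (RatFunc F) (B ^ (n + 1)) := by
  have hfac : (X - C p) * (B /ₘ (X - C p)) = B := mul_divByMonic_eq_iff_isRoot.2 hp
  have hq0 : B /ₘ (X - C p) ≠ 0 := fun h => hB (by rw [← hfac, h, mul_zero])
  have hB' : algebraMap F[X] (RatFunc F) B ≠ 0 :=
    (map_ne_zero_iff _ (IsFractionRing.injective F[X] (RatFunc F))).2 hB
  have hq' : algebraMap F[X] (RatFunc F) (B /ₘ (X - C p)) ≠ 0 :=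
    (map_ne_zero_iff _ (IsFractionRing.injective F[X] (RatFunc F))).2 hq0
  have hXp : (RatFunc.X - RatFunc.C p : RatFunc F) ≠ 0 := by
    rw [← RatFunc.algebraMap_X, ← RatFunc.algebraMap_C, ← map_sub,
      map_ne_zero_iff _ (IsFractionRing.injective F[X] (RatFunc F))]
    exact X_sub_C_ne_zero p
  have hfac' : (RatFunc.X - RatFunc.C p) * algebraMap F[X] (RatFunc F) (B /ₘ (X - C p)) =
      algebraMap F[X] (RatFunc F) B := by
    rw [← RatFunc.algebraMap_X, ← RatFunc.algebraMap_C, ← map_sub, ← map_mul, hfac]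
  rw [map_mul, map_pow, map_pow, Polynomial.smul_eq_C_mul, map_mul, RatFunc.algebraMap_C,
    eq_div_iff (pow_ne_zero _ hB')]
  have hinv : (RatFunc.X - RatFunc.C p)⁻¹ * algebraMap F[X] (RatFunc F) B =
      algebraMap F[X] (RatFunc F) (B /ₘ (X - C p)) := by
    rw [← hfac', ← mul_assoc, inv_mul_cancel₀ hXp, one_mul]
  calc RatFunc.C b * (RatFunc.X - RatFunc.C p)⁻¹ * algebraMap F[X] (RatFunc F) B ^ (n + 1)
      = RatFunc.C b * algebraMap F[X] (RatFunc F) B ^ n *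
          ((RatFunc.X - RatFunc.C p)⁻¹ * algebraMap F[X] (RatFunc F) B) := by ring
    _ = RatFunc.C b * algebraMap F[X] (RatFunc F) (B /ₘ (X - C p)) *
          algebraMap F[X] (RatFunc F) B ^ n := by rw [hinv]; ring

/-- Evaluating `B/(z - p)` at `c`: `(B/(z-p))(c) · (c - p) = B(c)`. -/
theorem eval_divByMonic_mul {B : F[X]} {p : F} (hp : B.IsRoot p) (c : F) :
    (B /ₘ (X - C p)).eval c * (c - p) = B.eval c := by
  have hfac : (X - C p) * (B /ₘ (X - C p)) = B := mul_divByMonic_eq_iff_isRoot.2 hp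
  conv_rhs => rw [← hfac]
  rw [eval_mul, eval_sub, eval_X, eval_C, mul_comm]

/-- Evaluating the coefficientwise derivative at a `D`-constant point `c` with `D(cʲ) = 0`
(e.g. `c ∈ {0, 1}`): `(M^D)(c) = D(M(c))`. -/
theorem eval_sum_monomial (D : Derivation k F F) (M : F[X]) {c : F} (hc : D c = 0) :
    (M.sum fun j a => monomial j (D a)).eval c = D (M.eval c) := by
  have hcpow : ∀ j : ℕ, D (c ^ j) = 0 := fun j => by
    rw [Derivation.leibniz_pow, hc, smul_zero, smul_zero]
  rw [Polynomial.sum_def, eval_finsetSum, Polynomial.eval_eq_sum, Polynomial.sum_def, map_sum]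
  refine Finset.sum_congr rfl fun j _ => ?_
  rw [eval_monomial, Derivation.leibniz, hcpow, smul_zero, zero_add, smul_eq_mul, mul_comm]

/-- `D` of the Landau function `g = (p-1)/p`: `g⁻¹ · Dg = Dp / (p (p - 1))`, in the form used by
the boundary step. -/
theorem landauFn_inv_mul_deriv (D : Derivation k F F) {p : F} (hp0 : p ≠ 0) (hp1 : p ≠ 1) (a : F) :
    a * (((p - 1) / p)⁻¹ * D ((p - 1) / p)) = -(a * D p * (1 / (1 - p) - 1 / (0 - p))) := by
  have hp1' : p - 1 ≠ 0 := sub_ne_zero.2 hp1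
  have hp1'' : 1 - p ≠ 0 := sub_ne_zero.2 (Ne.symm hp1)
  rw [Derivation.leibniz_div, map_sub, show ((1 : F)) = ((1 : ℕ) : F) by norm_num,
    Derivation.map_natCast]
  simp only [Nat.cast_one, sub_zero, smul_eq_mul]
  field_simp
  ring

/-- **Boundary step.** With `M′ := M^D·B - n·M·B^D - (Σᵢ aᵢ Dpᵢ · B/(z-pᵢ))·Bⁿ` (the numerator of
the corrected exact part `𝔇(M/Bⁿ) - Σ aᵢDpᵢ/(z-pᵢ)` over `Bⁿ⁺¹`), the boundary value satisfies
`[M′/Bⁿ⁺¹]₀¹ = D [M/Bⁿ]₀¹ + Σᵢ aᵢ · Dgᵢ/gᵢ`, `gᵢ = (pᵢ - 1)/pᵢ`. -/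
theorem boundary_step (D : Derivation k F F) {ι : Type*} [Fintype ι] (p a : ι → F) (B M : F[X])
    (n : ℕ) (hB0 : B.eval 0 ≠ 0) (hB1 : B.eval 1 ≠ 0) (hroot : ∀ i, B.IsRoot (p i))
    (M' : F[X])
    (hM' : M' = (M.sum fun j b => monomial j (D b)) * B - n • (M * B.sum fun j b => monomial j (D b))
      - (∑ i, (a i * D (p i)) • (B /ₘ (X - C (p i)))) * B ^ n) :
    M'.eval 1 / B.eval 1 ^ (n + 1) - M'.eval 0 / B.eval 0 ^ (n + 1) =
      D (M.eval 1 / B.eval 1 ^ n - M.eval 0 / B.eval 0 ^ n) +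
        ∑ i, a i * ((((p i) - 1) / p i)⁻¹ * D (((p i) - 1) / p i)) := by
  have hp0 : ∀ i, p i ≠ 0 := fun i h => hB0 (by have := hroot i; rwa [IsRoot.def, h] at this)
  have hp1 : ∀ i, p i ≠ 1 := fun i h => hB1 (by have := hroot i; rwa [IsRoot.def, h] at this)
  -- evaluation of `M′` at a point `c` with `Dc = 0`, `B(c) ≠ 0`
  have key : ∀ c : F, D c = 0 → B.eval c ≠ 0 →
      M'.eval c / B.eval c ^ (n + 1) =
        D (M.eval c / B.eval c ^ n) - ∑ i, a i * D (p i) * (1 / (c - p i)) := by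
    intro c hc hBc
    have hcp : ∀ i, c - p i ≠ 0 := fun i h => by
      have : c = p i := sub_eq_zero.1 h
      exact hBc (by rw [this]; exact hroot i)
    rw [hM', eval_sub, eval_sub, eval_mul, eval_smul, eval_mul, eval_mul, eval_pow,
      eval_finsetSum, eval_sum_monomial D M hc, eval_sum_monomial D B hc,
      derivation_div_pow D _ _ hBc n]
    have e : ∀ i ∈ (Finset.univ : Finset ι),
        ((a i * D (p i)) • (B /ₘ (X - C (p i)))).eval c =
          a i * D (p i) * (B.eval c / (c - p i)) := fun i _ => by
      rw [eval_smul, smul_eq_mul, ← eval_divByMonic_mul (hroot i) c, mul_div_cancel_right₀ _ (hcp i)]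
    rw [Finset.sum_congr rfl e, nsmul_eq_mul, sub_div]
    congr 1
    rw [pow_succ', mul_div_mul_right _ _ (pow_ne_zero n hBc), Finset.sum_div]
    refine Finset.sum_congr rfl fun i _ => ?_
    field_simp
  have h0 : D (0 : F) = 0 := map_zero D
  have h1 : D (1 : F) = 0 := by
    rw [show ((1 : F)) = ((1 : ℕ) : F) by norm_num, Derivation.map_natCast]
  rw [key 1 h1 hB1, key 0 h0 hB0, map_sub]
  have e2 : ∀ i ∈ (Finset.univ : Finset ι),
      a i * ((((p i) - 1) / p i)⁻¹ * D (((p i) - 1) / p i)) =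
        -(a i * D (p i) * (1 / (1 - p i) - 1 / (0 - p i))) := fun i _ =>
    landauFn_inv_mul_deriv D (hp0 i) (hp1 i) (a i)
  rw [Finset.sum_congr rfl e2]
  simp only [mul_sub, Finset.sum_sub_distrib, Finset.sum_neg_distrib]
  ring

end GaussManin

/-- **Registered sub-goal `kernel_gm_pack`** (packaging for the gate): existence of the two
commuting derivations `∂ = d/dz` and `𝔇` (coefficientwise `D`) on `F(z)`. -/
theorem kernel_gm_pack : ∀ {k : Type*} [Field k] {F : Type*} [Field F] [Algebra k F]
    (D : Derivation k F F), ∃ dz dc : Derivation k (RatFunc F) (RatFunc F),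
      (∀ p : Polynomial F, dz (algebraMap (Polynomial F) (RatFunc F) p) =
        algebraMap (Polynomial F) (RatFunc F) (Polynomial.derivative p)) ∧
      (∀ p : Polynomial F, dc (algebraMap (Polynomial F) (RatFunc F) p) =
        algebraMap (Polynomial F) (RatFunc F) (p.sum fun j a => Polynomial.monomial j (D a))) ∧
      (∀ f : RatFunc F, dc (dz f) = dz (dc f)) := by
  intro k _ F _ _ D
  obtain ⟨dz, hdz⟩ := exists_derivation_dz (k := k) (F := F)
  obtain ⟨dc, hdc⟩ := exists_derivation_coeff D
  exact ⟨dz, dc, hdz, hdc, fun f => dcoeff_dz_comm D dc dz hdc hdz f⟩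

end Summit.KontsevichZagierPeriods.InverseLandau.RationalCurves

end
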